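import Literature.Topology.FourManifolds.HomotopySpheresBPOrderProofs
import Literature.Topology.FourManifolds.HomotopySpheresSignatureProofs
import Literature.Topology.FourManifolds.IntersectionFormEven
import HarnessLib

/-!
# `|bP₈| = 28`: the home of the discharge of `HomotopySphereClass.natCard_bP_seven`

Topic `Literature/Topology/FourManifolds`; pure-proof leaf module next to `HomotopySpheresBPOrder.lean`,
the host of the named fact `Literature.Topology.FourManifolds.HomotopySphereClass.natCard_bP_seven`
(`Nat.card (bP 7) = 28`: the subgroup `bP₈ ⊆ Θ₇` of oriented-diffeomorphism classes of smooth
homotopy `7`-spheres bounding a compact parallelizable `8`-manifold has `28` elements — M. Kervaire,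
J. Milnor, *Groups of homotopy spheres I*, Ann. of Math. 77 (1963), §7, Thm. 7.5, Cor. 7.6 and the
Discussion pp. 530–531, "`bP₄ₘ` is cyclic of order precisely `σₘ/8`", `σ₂/8 = 28` being the entry
`Θ₇ : 28` of the table p. 504; complete printed proof: A. Kosinski, *Differential Manifolds*
(1993), Ch. X §6, Prop. 6.2(a) (p. 216) and p. 217, "Since `t₂/8 = 28`, it follows that
`bP⁸ = ℤ₂₈`"). Nothing imports this module, so the discharge `natCard_bP_seven_holds` can be
appended here importing whatever hosts the last `_holds` theorems without closing an import
cycle. Everything here is **proved**; no definition, no named fact, no statement is added or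
changed (net debt `0`).

The fact is glue over Kervaire–Milnor's §7 (`HomotopySphereClass.natCard_bP_seven_of`,
`HomotopySpheresBPOrderProofs.lean`: Thm. 7.5; the two comparisons between `bP₈` — bounding a
parallelizable manifold, §4 — and oriented s-parallelizable null-cobordisms, §7 with Lemma 3.4;
the image `8ℤ` of the signature, p. 530; `σ₂ = 224`, p. 530 and (2) p. 531). Of the nine named
facts of the finer assembly `HomotopySphereClass.natCard_bP_seven_of_manifoldLeaves'`
(`HomotopySpheresBPOrderSignatureProofs.lean`), five are now theorems of the tree:

* the two comparisons, `HomotopySphere.nonempty_signatureSet_of_boundsParallelizable_holds` and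
  `HomotopySphere.boundsParallelizable_of_mem_signatureSet_holds` (`HomotopySpheresSignatureProofs.lean`;
  Kervaire–Milnor §4 p. 510, Lemma 3.4 p. 509, footnote pp. 528–529);
* §2-additivity of `σ` over sums along the boundary,
  `HomotopySphere.add_mem_signatureSet_of_isOrientedConnectedSum_holds`
  (`HomotopySpheresSignatureConnectedSumHolds.lean`);
* Kosinski's X.(3.1), evenness of the intersection form of the closed model of an s-parallelizable
  null-cobordism — for EVERY such null-cobordism, connected or not
  (`HomotopySphere.isEven_intersectionForm_of_isStablyParallelizable`, `IntersectionFormEven.lean`,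
  by the Wu class), whence `8 ∣ σ(M)` on all of `signatureSet`
  (`HomotopySphere.eight_dvd_of_mem_signatureSet_holds`) WITHOUT first making `M` highly connected:
  Kosinski's X.2.2/X.3.3 (`HomotopySphere.exists_highlyConnected_of_mem_signatureSet`, surgery
  below the middle dimension) has left the frontier of `|bP₈| = 28`, and Kervaire–Milnor's `8ℤ`
  (`HomotopySphere.exists_mem_signatureSet_iff_eight_dvd`) follows from Milnor's `E₈`-plumbing
  alone (`HomotopySphere.exists_mem_signatureSet_iff_eight_dvd_of_e8Form`).

This file records the resulting frontier:

* `HomotopySphereClass.natCard_bP_seven_of_four_leaves` — **`|bP₈| = 28` from the FOUR named facts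
  that remain**: Kervaire–Milnor's Thm. 7.5 (`HomotopySphere.mk_eq_mk_iff_sigmaGen_dvd_sub`: framed
  surgery, Lemma 7.3, and the h-cobordism theorem); Milnor's `E₈`-plumbing `M(4m)`, Kosinski VI.12
  with IX.7.5 (`HomotopySphere.exists_intersectionForm_equivalent_e8Form`); and the two halves of
  `σ₂ = 224`, Kervaire–Milnor pp. 529–530 with Milnor–Kervaire [18, p. 457], Kosinski IX.8.7
  (`HomotopySphere.twoHundredTwentyFour_dvd_of_mem_signatureSet_sphere`: Hirzebruch's `L₂`, Bott
  integrality, `ker J₇`; `HomotopySphere.exists_twoHundredTwentyFour_mem_signatureSet_sphere`: a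
  closed almost parallelizable `8`-manifold of signature `224`).
* `HomotopySphereClass.natCard_bP_seven_of_three` — the same over Thm. 7.5 and the two aggregate
  facts of p. 530, `8ℤ` (`HomotopySphere.exists_mem_signatureSet_iff_eight_dvd`) and `σ₂ = 224`
  (`HomotopySphere.sigmaGen_two`), for use if their own discharges land first.

The discharge `natCard_bP_seven_holds` is either theorem applied to the corresponding `_holds`.

## References

* M. Kervaire, J. Milnor, *Groups of homotopy spheres I*, Ann. of Math. 77 (1963), 504–537:
  table p. 504; §2; Lemma 3.4 (p. 509); §4 (p. 510); §7: Lemma 7.3 (p. 528), footnote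
  pp. 528–529, Lemma 7.4 and Thm. 7.5 (pp. 529–530), Cor. 7.6 and Discussion (pp. 530–531),
  formula (2) p. 531. doi:10.2307/1970128 [KervaireMilnorAnnals1963]
* A. Kosinski, *Differential Manifolds*, Academic Press (1993), Ch. X §3 (3.1)–(3.4), §6
  Prop. 6.2(a) (p. 216) and p. 217 (`bP⁸ = ℤ₂₈`); VI.12; IX.7.5, IX.8.7. [Kosinski1993]
* J. Milnor, M. Kervaire, *Bernoulli numbers, homotopy groups, and a theorem of Rohlin*, Proc.
  ICM Edinburgh 1958, CUP (1960), 454–458 (reference [18] of Kervaire–Milnor).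
-/

noncomputable section

namespace Literature.Topology.FourManifolds

namespace HomotopySphereClass

/-- **`|bP₈| = 28` from the four named facts that remain** (Kervaire–Milnor 1963, §7: Thm. 7.5,
Cor. 7.6 and Discussion pp. 530–531, "`bP₄ₘ` is cyclic of order precisely `σₘ/8`", `σ₂/8 = 28`;
Kosinski 1993, Ch. X §6, Prop. 6.2(a) and p. 217). The canonical glue `natCard_bP_seven_of` fed:
Thm. 7.5 (`h75`); the discharged comparisons of `bP₈` with oriented s-parallelizable
null-cobordisms (`HomotopySphere.nonempty_signatureSet_of_boundsParallelizable_holds`,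
`HomotopySphere.boundsParallelizable_of_mem_signatureSet_holds`); Kervaire–Milnor's `8ℤ` from
Milnor's `E₈`-plumbing alone (`HomotopySphere.exists_mem_signatureSet_iff_eight_dvd_of_e8Form hΓ`:
`8 ∣ σ(M)` for every s-parallelizable `M` by the Wu class and van der Blij's lemma, every `8k`
occurs by §2-additivity — all theorems of the tree); and `σ₂ = 224` from its two halves
(`HomotopySphere.sigmaGen_two_of hdvd hex`). The discharge `natCard_bP_seven_holds` is this
theorem applied to the four `_holds`. [cite: KervaireMilnorAnnals1963, §7, Thm. 7.5, Cor. 7.6 and Discussion pp. 530–531; table p. 504 (Θ₇: 28)] [cite: Kosinski1993, Ch. X §6, Prop. 6.2(a) (p. 216) and p. 217 (t₂/8 = 28, bP⁸ = ℤ₂₈)] -/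
theorem natCard_bP_seven_of_four_leaves
    (h75 : HomotopySphere.mk_eq_mk_iff_sigmaGen_dvd_sub)
    (hΓ : HomotopySphere.exists_intersectionForm_equivalent_e8Form)
    (hdvd : HomotopySphere.twoHundredTwentyFour_dvd_of_mem_signatureSet_sphere)
    (hex : HomotopySphere.exists_twoHundredTwentyFour_mem_signatureSet_sphere) :
    natCard_bP_seven :=
  natCard_bP_seven_of h75 HomotopySphere.nonempty_signatureSet_of_boundsParallelizable_holds
    HomotopySphere.boundsParallelizable_of_mem_signatureSet_holds
    (HomotopySphere.exists_mem_signatureSet_iff_eight_dvd_of_e8Form hΓ)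
    (HomotopySphere.sigmaGen_two_of hdvd hex)

/-- **`|bP₈| = 28` from Thm. 7.5 and the two aggregate facts of p. 530** (Kervaire–Milnor 1963,
§7: "a given integer `σ` occurs as `σ(M)` for some s-parallelizable `M` bounded by a homotopy
sphere if and only if `σ ≡ 0 (mod 8)`" — `HomotopySphere.exists_mem_signatureSet_iff_eight_dvd` —
and `σ₂ = 224` from the formula for `σₘ`, p. 530 with (2) p. 531 — `HomotopySphere.sigmaGen_two`;
Kosinski 1993, Ch. X §6, Prop. 6.2(a) and p. 217): the canonical glue `natCard_bP_seven_of` with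
the two comparison facts fed their discharges. [cite: KervaireMilnorAnnals1963, §7, Thm. 7.5, Cor. 7.6 and Discussion pp. 530–531; table p. 504 (Θ₇: 28)] [cite: Kosinski1993, Ch. X §6, Prop. 6.2(a) (p. 216) and p. 217] -/
theorem natCard_bP_seven_of_three
    (h75 : HomotopySphere.mk_eq_mk_iff_sigmaGen_dvd_sub)
    (h8 : HomotopySphere.exists_mem_signatureSet_iff_eight_dvd)
    (h224 : HomotopySphere.sigmaGen_two) : natCard_bP_seven :=
  natCard_bP_seven_of h75 HomotopySphere.nonempty_signatureSet_of_boundsParallelizable_holds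
    HomotopySphere.boundsParallelizable_of_mem_signatureSet_holds h8 h224

end HomotopySphereClass

end Literature.Topology.FourManifolds
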